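import Literature.Geometry.Kaehler.DDcPowRadial
import Literature.Geometry.Kaehler.AnalyticSetChain
import Literature.Analysis.Pluripotential.RegularisedMax
import HarnessLib

/-!
# Levi positivity of radial, projected-radial and max weights; positivity of `[T] ∧ (dd^c w)ᵖ`

The plurisubharmonic test weights of the Monge–Ampère comparison argument for Lelong numbers
([Demailly, *Complex analytic and differential geometry*, Ch. III Thm. 7.1, 7.7];
[Chirka1989, §15.1]) are regularised maxima of `F(‖z - a‖²)` and `G(‖π(z - a)‖²)` for profile
weights `F, G` (`F' ≥ 0`, `F' + t F'' ≥ 0`, `RadialProfileWeight.lean`) and a complex-linear `π`.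
This file proves that such weights have non-negative **Levi form**
`Levi(w)(x)(v) = D²w(x)(v, v) + D²w(x)(iv, iv)` and hence non-negative Monge–Ampère densities on
the carrier of every holomorphic chain:

* `levi_comp_norm_sq` — `Levi(F(‖·‖²))(z)(v) = 4(F'(‖z‖²) ‖v‖² + F''(‖z‖²) |⟨z, v⟩|²)`, hence `≥ 0`
  when `F' ≥ 0` and `F' + ‖z‖² F'' ≥ 0` (`levi_comp_norm_sq_nonneg`, Cauchy–Schwarz);
* `fderiv_fderiv_comp_clm_apply`, `levi_comp_clm` — `Levi(g ∘ π)(z)(v) = Levi(g)(πz)(πv)` for a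
  continuous `ℂ`-linear `π`;
* `fderiv_fderiv_comp_sub`, `fderiv_fderiv_const_mul_add_const`, `levi_const_mul_add_const_nonneg` —
  translations, positive multiples and additive constants;
* `levi_smoothMax_nonneg` — the regularised maximum of two `C²` functions with non-negative Levi
  forms has non-negative Levi form (the tree's lemma, here on any complex normed space);
* `HolomorphicChain.twoPow_ddcForm_orientationFrame_nonneg` — **for a `C²` weight `w` with
  `Levi(w) ≥ 0` everywhere, `(dd^c w)(z)ᵖ(ξ_T(z)) ≥ 0` at every carrier point** of a holomorphic
  `p`-chain (`DDcPowComplexFrame.lean`: `p! ∏ 2λᵢ ≥ 0`).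

## References

* J.-P. Demailly, *Complex analytic and differential geometry*, Ch. I (5.18) (regularised max),
  Ch. III §7 (comparison theorems).
* E. M. Chirka, *Complex Analytic Sets*, Kluwer 1989, §13.2, §15.1 [Chirka1989].
* L. Hörmander, *An introduction to complex analysis in several variables*, Thm. 2.6.2.
-/

noncomputable section

open scoped InnerProductSpace Topology
open Set Filter Complex Module

universe u

namespace Literature.Geometry.Kaehler

open Literature.Analysis.Pluripotential TwoForm

variable {V : Type*} [NormedAddCommGroup V] [InnerProductSpace ℂ V]

/-! ### Radial weights -/

section Radial

variable {F : ℝ → ℝ}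

/-- **The Levi form of a radial weight**: `Levi(F(‖·‖²))(z)(v) = 4(F' ‖v‖² + F'' |⟨z, v⟩|²)`.
[cite: Chirka1989, §13.2] -/
theorem levi_comp_norm_sq (hF : ContDiff ℝ 2 F) (z v : V) :
    fderiv ℝ (fderiv ℝ (fun y : V => F (‖y‖ ^ 2))) z v v +
        fderiv ℝ (fderiv ℝ (fun y : V => F (‖y‖ ^ 2))) z (I • v) (I • v) =
      4 * (deriv F (‖z‖ ^ 2) * ‖v‖ ^ 2 + deriv (deriv F) (‖z‖ ^ 2) * ‖⟪z, v⟫_ℂ‖ ^ 2) := by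
  rw [fderiv_fderiv_comp_norm_sq_apply hF, fderiv_fderiv_comp_norm_sq_apply hF]
  have h1 : (⟪v, v⟫_ℂ).re = ‖v‖ ^ 2 := by rw [inner_self_eq_norm_sq_to_K]; norm_cast
  have h2 : (⟪I • v, I • v⟫_ℂ).re = ‖v‖ ^ 2 := by
    rw [inner_self_eq_norm_sq_to_K, norm_smul, Complex.norm_I, one_mul]; norm_cast
  rw [h2, h1]
  simp only [inner_smul_right, mul_re, I_re, I_im, zero_mul, one_mul, zero_sub, Complex.sq_norm, Complex.normSq_apply]
  ring

/-- **Radial weights with `F' ≥ 0`, `F' + tF'' ≥ 0` are plurisubharmonic**: their Levi form is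
non-negative. [cite: Chirka1989, §13.2] -/
theorem levi_comp_norm_sq_nonneg (hF : ContDiff ℝ 2 F) (z : V) (h1 : 0 ≤ deriv F (‖z‖ ^ 2))
    (h2 : 0 ≤ deriv F (‖z‖ ^ 2) + ‖z‖ ^ 2 * deriv (deriv F) (‖z‖ ^ 2)) (v : V) :
    0 ≤ fderiv ℝ (fderiv ℝ (fun y : V => F (‖y‖ ^ 2))) z v v +
        fderiv ℝ (fderiv ℝ (fun y : V => F (‖y‖ ^ 2))) z (I • v) (I • v) := by
  rw [levi_comp_norm_sq hF]
  have hcs : ‖⟪z, v⟫_ℂ‖ ^ 2 ≤ ‖z‖ ^ 2 * ‖v‖ ^ 2 := by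
    rw [← mul_pow]; exact pow_le_pow_left₀ (norm_nonneg _) (norm_inner_le_norm z v) 2
  by_cases hF'' : 0 ≤ deriv (deriv F) (‖z‖ ^ 2)
  · positivity
  · have : deriv (deriv F) (‖z‖ ^ 2) * (‖z‖ ^ 2 * ‖v‖ ^ 2) ≤
        deriv (deriv F) (‖z‖ ^ 2) * ‖⟪z, v⟫_ℂ‖ ^ 2 :=
      mul_le_mul_of_nonpos_left hcs (not_le.1 hF'').le
    nlinarith [sq_nonneg ‖v‖, mul_nonneg (sq_nonneg ‖v‖) h2]

end Radial

/-! ### Composition with a continuous linear map -/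

section CLM

variable {P : Type*} [NormedAddCommGroup P] [NormedSpace ℂ P]

/-- **The Hessian of `g ∘ π`** for a continuous real-linear `π`:
`D²(g ∘ π)(z)(a)(b) = D²g(πz)(πa)(πb)`. [folklore] -/
theorem fderiv_fderiv_comp_clm_apply (π : V →L[ℝ] P) {g : P → ℝ} (hg : ContDiff ℝ 2 g) (z a b : V) :
    fderiv ℝ (fderiv ℝ (fun y => g (π y))) z a b = fderiv ℝ (fderiv ℝ g) (π z) (π a) (π b) := by
  have hg1 : Differentiable ℝ g := hg.differentiable (by norm_num)
  have hg2 : Differentiable ℝ (fderiv ℝ g) :=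
    (hg.fderiv_right (m := 1) le_rfl).differentiable one_ne_zero
  have h1 : fderiv ℝ (fun y => g (π y)) = fun y => (fderiv ℝ g (π y)).comp π := by
    funext y
    exact ((hg1 (π y)).hasFDerivAt.comp y π.hasFDerivAt).fderiv
  rw [h1]
  have h2 : HasFDerivAt (fun y => (fderiv ℝ g (π y)).comp π)
      ((ContinuousLinearMap.precomp ℝ π).comp ((fderiv ℝ (fderiv ℝ g) (π z)).comp π)) z := by
    have hG : HasFDerivAt (fun y => fderiv ℝ g (π y)) ((fderiv ℝ (fderiv ℝ g) (π z)).comp π) z :=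
      (hg2 (π z)).hasFDerivAt.comp z π.hasFDerivAt
    exact (ContinuousLinearMap.precomp ℝ π).hasFDerivAt.comp z hG
  rw [h2.fderiv]
  rfl

/-- **`Levi(g ∘ π)(z)(v) = Levi(g)(πz)(πv)`** for a continuous `ℂ`-linear `π`. [folklore] -/
theorem levi_comp_clm (π : V →L[ℂ] P) {g : P → ℝ} (hg : ContDiff ℝ 2 g) (z v : V) :
    fderiv ℝ (fderiv ℝ (fun y => g (π y))) z v v +
        fderiv ℝ (fderiv ℝ (fun y => g (π y))) z (I • v) (I • v) =
      fderiv ℝ (fderiv ℝ g) (π z) (π v) (π v) +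
        fderiv ℝ (fderiv ℝ g) (π z) (I • π v) (I • π v) := by
  have h := fderiv_fderiv_comp_clm_apply (π.restrictScalars ℝ) hg z
  simp only [ContinuousLinearMap.coe_restrictScalars'] at h
  rw [h, h, π.map_smul]

end CLM

/-! ### Translations, multiples, constants -/

section Affine

/-- **The Hessian of a translate**: `D²(u(· - a))(z) = D²u(z - a)`. [folklore] -/
theorem fderiv_fderiv_comp_sub (u : V → ℝ) (a z : V) :
    fderiv ℝ (fderiv ℝ (fun y => u (y - a))) z = fderiv ℝ (fderiv ℝ u) (z - a) := by
  have h1 : fderiv ℝ (fun y => u (y - a)) = fun y => fderiv ℝ u (y - a) := funext fun y => fderiv_comp_sub a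
  rw [h1, fderiv_comp_sub]

/-- The Hessian of `l u + c`. [folklore] -/
theorem fderiv_fderiv_const_mul_add_const {u : V → ℝ} (hu : ContDiff ℝ 2 u) (l c : ℝ) (z : V) :
    fderiv ℝ (fderiv ℝ (fun y => l * u y + c)) z = l • fderiv ℝ (fderiv ℝ u) z := by
  have hu1 : Differentiable ℝ u := hu.differentiable (by norm_num)
  have hu2 : Differentiable ℝ (fderiv ℝ u) :=
    (hu.fderiv_right (m := 1) le_rfl).differentiable one_ne_zero
  have h1 : fderiv ℝ (fun y => l * u y + c) = fun y => l • fderiv ℝ u y := by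
    funext y
    rw [fderiv_add_const, fderiv_const_mul (hu1 y)]
  rw [h1]
  exact fderiv_const_smul (hu2 z) l

/-- `Levi(l u + c) = l Levi(u)`; in particular non-negativity is preserved for `l ≥ 0`. [folklore] -/
theorem levi_const_mul_add_const_nonneg {u : V → ℝ} (hu : ContDiff ℝ 2 u) {l : ℝ} (hl : 0 ≤ l) (c : ℝ)
    {z : V} (h : ∀ v, 0 ≤ fderiv ℝ (fderiv ℝ u) z v v + fderiv ℝ (fderiv ℝ u) z (I • v) (I • v)) (v : V) :
    0 ≤ fderiv ℝ (fderiv ℝ (fun y => l * u y + c)) z v v +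
        fderiv ℝ (fderiv ℝ (fun y => l * u y + c)) z (I • v) (I • v) := by
  rw [fderiv_fderiv_const_mul_add_const hu]
  change 0 ≤ l * fderiv ℝ (fderiv ℝ u) z v v + l * fderiv ℝ (fderiv ℝ u) z (I • v) (I • v)
  rw [← mul_add]
  exact mul_nonneg hl (h v)

end Affine

/-! ### The regularised maximum -/

section SmoothMax

/-- **The regularised maximum of two `C²` functions with non-negative Levi forms has non-negative
Levi form** (the tree's `levi_smoothMax_nonneg`, on an arbitrary complex normed space): its Levi
form is `½(1+σ)·Levi(a) + ½(1-σ)·Levi(b) + σ'/(2η)(|∂(a-b)·v|² + |∂(a-b)·iv|²)`.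
[cite: HormanderSCV1973, Thm. 2.6.2] -/
theorem levi_smoothMax_nonneg {W : Type*} [NormedAddCommGroup W] [NormedSpace ℂ W]
    {a b : W → ℝ} {w : W} {η : ℝ} (hη : 0 < η) (ha : ContDiffAt ℝ 2 a w) (hb : ContDiffAt ℝ 2 b w)
    (hLa : ∀ v, 0 ≤ fderiv ℝ (fderiv ℝ a) w v v + fderiv ℝ (fderiv ℝ a) w (I • v) (I • v))
    (hLb : ∀ v, 0 ≤ fderiv ℝ (fderiv ℝ b) w v v + fderiv ℝ (fderiv ℝ b) w (I • v) (I • v))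
    (v : W) :
    0 ≤ fderiv ℝ (fderiv ℝ (fun z ↦ smoothMax η (a z) (b z))) w v v
      + fderiv ℝ (fderiv ℝ (fun z ↦ smoothMax η (a z) (b z))) w (I • v) (I • v) := by
  rw [fderiv_fderiv_smoothMax_apply hη.ne' ha hb v, fderiv_fderiv_smoothMax_apply hη.ne' ha hb (I • v)]
  set σ := smoothSign ((a w - b w) / η)
  set σ' := deriv smoothSign ((a w - b w) / η)
  have hσ1 : 0 ≤ (1 + σ) / 2 := by linarith [neg_one_le_smoothSign ((a w - b w) / η)]
  have hσ2 : 0 ≤ (1 - σ) / 2 := by linarith [smoothSign_le_one ((a w - b w) / η)]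
  have hσ' : 0 ≤ σ' / (2 * η) := div_nonneg (deriv_smoothSign_nonneg _) (by linarith)
  have key : (1 + σ) / 2 * fderiv ℝ (fderiv ℝ a) w v v
      + (1 - σ) / 2 * fderiv ℝ (fderiv ℝ b) w v v
      + σ' / (2 * η) * (fderiv ℝ a w v - fderiv ℝ b w v) ^ 2
      + ((1 + σ) / 2 * fderiv ℝ (fderiv ℝ a) w (I • v) (I • v)
      + (1 - σ) / 2 * fderiv ℝ (fderiv ℝ b) w (I • v) (I • v)
      + σ' / (2 * η) * (fderiv ℝ a w (I • v) - fderiv ℝ b w (I • v)) ^ 2)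
      = (1 + σ) / 2 * (fderiv ℝ (fderiv ℝ a) w v v + fderiv ℝ (fderiv ℝ a) w (I • v) (I • v))
      + (1 - σ) / 2 * (fderiv ℝ (fderiv ℝ b) w v v + fderiv ℝ (fderiv ℝ b) w (I • v) (I • v))
      + σ' / (2 * η) * ((fderiv ℝ a w v - fderiv ℝ b w v) ^ 2
        + (fderiv ℝ a w (I • v) - fderiv ℝ b w (I • v)) ^ 2) := by ring
  rw [key]
  have := hLa v
  have := hLb v
  positivity

end SmoothMax

/-! ### Positivity of `[T] ∧ (dd^c w)ᵖ` for plurisubharmonic `C²` weights -/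

section Chain

variable {V : Type u} [NormedAddCommGroup V] [InnerProductSpace ℂ V] [FiniteDimensional ℂ V]
  [MeasurableSpace V] [BorelSpace V] {Ω : TopologicalSpace.Opens V} {p : ℕ}

/-- **Positivity of the Monge–Ampère densities of plurisubharmonic `C²` weights along holomorphic
chains**: if `w` is `C²` with `Levi(w)(z) ≥ 0`, then `(dd^c w)(z)ᵖ(ξ_T(z)) ≥ 0` at every carrier
point `z` of a holomorphic `p`-chain `T`. [cite: Chirka1989, §13.2] -/
theorem HolomorphicChain.twoPow_ddcForm_orientationFrame_nonneg
    (T : HolomorphicChain (modelWithCornersSelf ℂ V) Ω p)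
    {w : V → ℝ} {z : V} (hw : ContDiffAt ℝ 2 w z)
    (hpsh : ∀ v, 0 ≤ fderiv ℝ (fderiv ℝ w) z v v + fderiv ℝ (fderiv ℝ w) z (I • v) (I • v))
    (hz : z ∈ T.carrier) :
    0 ≤ (ddcForm w z).twoPow p (T.orientationFrame z) := by
  obtain ⟨u, hu, hξ⟩ := T.exists_orientationFrame_eq_complexFrame hz
  rw [hξ]
  have hw2 : DifferentiableAt ℝ (fderiv ℝ w) z :=
    (hw.fderiv_right (m := 1) le_rfl).differentiableAt one_ne_zero
  have hsym : ∀ a b : V, fderiv ℝ (fderiv ℝ w) z a b = fderiv ℝ (fderiv ℝ w) z b a :=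
    hw.isSymmSndFDerivAt (by simp)
  set K := Submodule.span ℂ (range u) with hK
  have hKp : finrank ℂ K = p := by
    rw [hK, finrank_span_eq_card hu.linearIndependent, Fintype.card_fin]
  exact twoPow_ddcForm_complexFrame_nonneg hw2 hsym K hKp (fun a _ => hpsh a) hu
    fun i => Submodule.subset_span (mem_range_self i)

end Chain

end Literature.Geometry.Kaehler

end
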